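import Summits.KontsevichZagierPeriods.Zeta5Search.Barrier.ConeGammaCritConcrete
import Summits.KontsevichZagierPeriods.Zeta5Search.Barrier.ConeGammaCritBranches
import Summits.KontsevichZagierPeriods.Zeta5Search.Barrier.ConeGammaLogCuspGamma
import Summits.KontsevichZagierPeriods.Zeta5Search.Barrier.ConeGammaContinuity

/-!
# ζ(5) search — BARRIER: `Regular` is STABLE in the open box, `C₁`/`C₀` are locally Lipschitz, log-cusp of `γ`

HONEST FRAMING (cell `pub-zeta5`): systematic search; no irrationality claim unless kernel-certified. MODEL objects
under Brown–Zudilin's (28)+(30) accounting ([BZ22] = arXiv:2210.03391; (28) observed, not proved); statements about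
BZ's §5 critical system and the sSup-form `C1`/`C0`/`Regular`/`gamma` of `ConeGammaRates`; nothing here is a
statement about the size of any critical value, the cone's supremum (C2 = `BarrierC2`, OPEN), S-E (CONJECTURED) or
`ζ(5)`. No number or sentence of record moves. Records in print UNMOVED. Prover P2 g23 (self-selected Lean-only item
«BZ's cubic (20) in the kernel», file 5: the «implicit function theorem on BZ's critical system — NOT in the tree» of
`ConeGammaLogCuspGamma`'s docstring is now in the tree, via the cubic resolvent (`ConeGammaCritCubic`), root tracking
by the intermediate value theorem (`ConeGammaCritRootTracking`, `ConeGammaCritBranches`) and the concrete inputs of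
`ConeGammaCritConcrete`).

* **`regular_stable_aOfS`, `regular_stable`** — MAIN: at a Regular open-box direction `a` (`s = sParam a`) there are
  `η > 0`, `L ≥ 0` such that every `s′` with `‖s′ − s‖∞ ≤ η` is an open-box parameter with `Regular (aOfS s′)`,
  `|C1 (aOfS s′) − C1 a| ≤ L‖s′ − s‖` and `|C0 (aOfS s′) − C0 a| ≤ L‖s′ − s‖` (so `Regular` is an OPEN condition
  in the open box, and `C₁`, `C₀` are locally Lipschitz there in the symmetric coordinates);
* **`gamma_logCusp_of_regular`** — `ConeGammaLogCuspGamma.gamma_logCusp_of_lipschitz` with its two Lipschitz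
  hypotheses DISCHARGED: at every Regular open-box direction with `Q = C₁ + δ₂₈ − Φ > 0`, for every period `T` and
  displacement `δ`, `|γ(s(a)+εδ) − γ(a) − ((C₁−C₀)/Q²)(σ/T)·ε·log(1/ε)| ≤ C′ε` for `0 < ε ≤ ε₄` (hypotheses left:
  open box, Regular, `Q > 0`, a period `T` of the forms, the displacement `δ`).
* `continuous_sParam`, `isOpen_openBox`, **`isOpen_regular_openBox`** — the set of Regular open-box DIRECTIONS is
  open in `Dir = ℝ⁸`; **`continuousAt_C1_of_regular`, `continuousAt_C0_of_regular`, `continuousAt_delta28`,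
  `continuousAt_phi30_of_openBox`, `continuousAt_gamma_of_regular`** — `C₁`, `C₀` are continuous at every Regular
  open-box direction, and so is `γ` wherever its denominator `C₁ + δ₂₈ − Φ` is non-zero (with the tree's
  `continuousWithinAt_phi30` and `abs_delta28_sub_le_sParam`) — the «continuity of `C₀`, `C₁`, `γ` (sSup-defined)»
  left open in `ConeGammaContinuity`'s docstring, on the Regular open-box stratum.
NOT here (honest): the sign or size of `σ` anywhere, any constant of record, the closed-box faces and the loss loci
(where `Regular` fails — there `γ` is not a number of record and nothing is claimed), anything about C2 or `ζ(5)`.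
-/

noncomputable section

open Set Metric
open scoped Topology

namespace Summit.KontsevichZagierPeriods.Zeta5Search.Barrier.ConeGamma

/-! ### MAIN: `Regular` persists and `C₁`, `C₀` move Lipschitz-ly -/

/-- **MAIN (symmetric coordinates).** At a Regular open-box parameter `s` there are `η > 0`, `L ≥ 0` such that
every `s′` with `‖s′ − s‖∞ ≤ η` is an open-box parameter with `Regular (aOfS s′)`,
`|C1 (aOfS s′) − C1 (aOfS s)| ≤ L·‖s′ − s‖` and `|C0 (aOfS s′) − C0 (aOfS s)| ≤ L·‖s′ − s‖`. -/
theorem regular_stable_aOfS {s : Fin 8 → ℝ} (hbox : ∀ j : Fin 7, 0 < s j.succ ∧ s j.succ < s 0)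
    (hreg : Regular (aOfS s)) :
    ∃ η L : ℝ, 0 < η ∧ 0 ≤ L ∧ ∀ s' : Fin 8 → ℝ, ‖s' - s‖ ≤ η →
      (∀ j : Fin 7, 0 < s' j.succ ∧ s' j.succ < s' 0) ∧ Regular (aOfS s') ∧
      |C1 (aOfS s') - C1 (aOfS s)| ≤ L * ‖s' - s‖ ∧ |C0 (aOfS s') - C0 (aOfS s)| ≤ L * ‖s' - s‖ := by
  obtain ⟨Y₁, Y₂, Y₃, a, hfac, ha, h12, h13, h23, hS₁, hS₂, hS₃, hv12, hv23⟩ := exists_roots_of_regular hbox hreg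
  dsimp only at hS₁ hS₂ hS₃ hv12 hv23
  obtain ⟨ηc, hηc, hboxc⟩ := exists_openBox_ball hbox
  have key := exists_three_branches (E := Fin 8 → ℝ)
    (C := fun s Y => (-((Y + s 3) * (Y + s 4) * (Y + s 6) * (Y + s 5)) * (s 1 + s 2 + s 7 - Y) ^ 2 * (s 0 - Y) + (2 *
      Y ^ 3 - 2 * (s 0 - (s 3 + s 4 + s 6 + s 5)) * Y ^ 2 - (s 0 * (s 3 + s 4 + s 6 + s 5) - (s
      3 * s 4 + s 3 * s 6 + s 3 * s 5 + s 4 * s 6 + s 4 * s 5 + s 6 * s 5)) * Y - (s 0 * (s 3 *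
      s 4 + s 3 * s 6 + s 3 * s 5 + s 4 * s 6 + s 4 * s 5 + s 6 * s 5) - (s 3 * s 4 * s 6 + s 3
      * s 4 * s 5 + s 3 * s 6 * s 5 + s 4 * s 6 * s 5))) * (s 1 + s 2 + s 7 - Y) * ((Y - s 1) *
      (Y - s 2) * (Y - s 7)) + (Y - s 0 + (s 3 + s 4 + s 6 + s 5)) * ((Y - s 1) * (Y - s 2) * (Y
      - s 7)) ^ 2))
    (G := fun p => ((p.2 + p.1 6) * ((p.1 1 + p.1 2 + p.1 7 - p.2) * (p.1 0 - p.2)) - (p.2 - p.1 1) * (p.2 - p.1 2)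
      * (p.2 - p.1 7)) * ((p.1 6 - p.2 + (p.1 6 - p.1 0) * ((p.2 - p.1 1) * (p.2 - p.1 2) * (p.2
      - p.1 7)) / ((p.2 + p.1 6) * ((p.1 1 + p.1 2 + p.1 7 - p.2) * (p.1 0 - p.2)) - (p.2 - p.1
      1) * (p.2 - p.1 2) * (p.2 - p.1 7))) - (p.1 4 + p.1 6)) * ((p.1 6 - p.2 + (p.1 6 - p.1 0)
      * ((p.2 - p.1 1) * (p.2 - p.1 2) * (p.2 - p.1 7)) / ((p.2 + p.1 6) * ((p.1 1 + p.1 2 + p.1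
      7 - p.2) * (p.1 0 - p.2)) - (p.2 - p.1 1) * (p.2 - p.1 2) * (p.2 - p.1 7))) - (p.1 3 + p.1
      6)) * ((p.1 6 - p.2 + (p.1 6 - p.1 0) * ((p.2 - p.1 1) * (p.2 - p.1 2) * (p.2 - p.1 7)) /
      ((p.2 + p.1 6) * ((p.1 1 + p.1 2 + p.1 7 - p.2) * (p.1 0 - p.2)) - (p.2 - p.1 1) * (p.2 -
      p.1 2) * (p.2 - p.1 7))) - (p.1 5 + p.1 6)) * ((p.1 6 - p.2 + (p.1 6 - p.1 0) * ((p.2 -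
      p.1 1) * (p.2 - p.1 2) * (p.2 - p.1 7)) / ((p.2 + p.1 6) * ((p.1 1 + p.1 2 + p.1 7 - p.2)
      * (p.1 0 - p.2)) - (p.2 - p.1 1) * (p.2 - p.1 2) * (p.2 - p.1 7))) + (p.2 + p.1 6) - (p.1
      0 + p.1 6)) * (p.1 0 + p.1 6 - (p.1 6 - p.2 + (p.1 6 - p.1 0) * ((p.2 - p.1 1) * (p.2 -
      p.1 2) * (p.2 - p.1 7)) / ((p.2 + p.1 6) * ((p.1 1 + p.1 2 + p.1 7 - p.2) * (p.1 0 - p.2))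
      - (p.2 - p.1 1) * (p.2 - p.1 2) * (p.2 - p.1 7)))) * (p.1 3 + p.1 4 + p.1 5 + p.1 6 - (p.1
      6 - p.2 + (p.1 6 - p.1 0) * ((p.2 - p.1 1) * (p.2 - p.1 2) * (p.2 - p.1 7)) / ((p.2 + p.1
      6) * ((p.1 1 + p.1 2 + p.1 7 - p.2) * (p.1 0 - p.2)) - (p.2 - p.1 1) * (p.2 - p.1 2) *
      (p.2 - p.1 7)))) * ((p.1 6 - p.2 + (p.1 6 - p.1 0) * ((p.2 - p.1 1) * (p.2 - p.1 2) * (p.2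
      - p.1 7)) / ((p.2 + p.1 6) * ((p.1 1 + p.1 2 + p.1 7 - p.2) * (p.1 0 - p.2)) - (p.2 - p.1
      1) * (p.2 - p.1 2) * (p.2 - p.1 7))) + (p.2 + p.1 6) - 2 * p.1 6) * ((p.2 + p.1 6) - (p.1
      6 + p.1 7)) * ((p.2 + p.1 6) - (p.1 2 + p.1 6)) * ((p.2 + p.1 6) - (p.1 1 + p.1 6)) * (p.1
      1 + p.1 2 + p.1 6 + p.1 7 - (p.2 + p.1 6)) * (p.1 0 + p.1 6 - (p.2 + p.1 6)))
    (V := fun p => growthLogR (pR (aOfS p.1)) (qR (aOfS p.1)) (p.1 6 - p.2 + (p.1 6 - p.1 0) * ((p.2 - p.1 1) *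
      (p.2 - p.1 2) * (p.2 - p.1 7)) / ((p.2 + p.1 6) * ((p.1 1 + p.1 2 + p.1 7 - p.2) * (p.1 0
      - p.2)) - (p.2 - p.1 1) * (p.2 - p.1 2) * (p.2 - p.1 7))) (p.2 + p.1 6))
    (S := fun s => critVals (aOfS s)) (s := s)
    (fun Y => contDiff_critCubic.contDiffAt) continuous_critCubic hfac ha h12 h13 h23
    (continuousAt_critSide hS₁) (continuousAt_critSide hS₂) (continuousAt_critSide hS₃) hS₁ hS₂ hS₃
    (contDiffAt_critValue hbox hS₁) (contDiffAt_critValue hbox hS₂) (contDiffAt_critValue hbox hS₃)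
    hv12 hv23 hηc
    (fun s' Y _ hC hG => critValue_mem_critVals hC hG)
    (fun s' hs => critVals_aOfS_finite_of_openBox (hboxc s' hs))
  obtain ⟨η, M, hη, hηle, hM, hall⟩ := key
  -- the base values at `s' = s`
  obtain ⟨u₁, u₂, u₃, hSs, hu12, hu23, hd₁, hd₂, hd₃⟩ := hall s (by rw [sub_self, norm_zero]; exact hη.le)
  rw [sub_self, norm_zero, mul_zero] at hd₂ hd₃
  have hu₂ := sub_eq_zero.mp (abs_nonpos_iff.mp hd₂)
  have hu₃ := sub_eq_zero.mp (abs_nonpos_iff.mp hd₃)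
  have hC1s : C1 (aOfS s) = u₃ := C1_eq_of_critVals_eq_three hSs hu12 hu23
  have hC0s : C0 (aOfS s) = u₂ := C0_eq_of_critVals_eq_three hSs hu12 hu23
  refine ⟨η, M, hη, hM, fun s' hs' => ⟨hboxc s' (hs'.trans hηle), ?_⟩⟩
  obtain ⟨v₁, v₂, v₃, hS', h12', h23', he₁, he₂, he₃⟩ := hall s' hs'
  refine ⟨regular_of_critVals_eq_three hS' h12'.ne (h12'.trans h23').ne h23'.ne, ?_, ?_⟩
  · rw [C1_eq_of_critVals_eq_three hS' h12' h23', hC1s, hu₃]; exact he₃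
  · rw [C0_eq_of_critVals_eq_three hS' h12' h23', hC0s, hu₂]; exact he₂

/-- **MAIN (directions).** At a Regular open-box direction `a`: `η > 0`, `L ≥ 0` with: every `s′` within `η` of
`sParam a` (sup-distance) is an open-box parameter, `aOfS s′` is Regular, and
`|C1 (aOfS s′) − C1 a|, |C0 (aOfS s′) − C0 a| ≤ L·‖s′ − sParam a‖`. In particular `C₁`, `C₀` are Lipschitz along
every ray `ε ↦ aOfS (sParam a + ε·δ)` for small `ε` — the hypothesis of `gamma_logCusp_of_lipschitz`. -/
theorem regular_stable {a : Dir} (hopen : ∀ j : Fin 7, 0 < sParam a j.succ ∧ sParam a j.succ < sParam a 0)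
    (hreg : Regular a) :
    ∃ η L : ℝ, 0 < η ∧ 0 ≤ L ∧ ∀ s' : Fin 8 → ℝ, ‖s' - sParam a‖ ≤ η →
      (∀ j : Fin 7, 0 < s' j.succ ∧ s' j.succ < s' 0) ∧ Regular (aOfS s') ∧
      |C1 (aOfS s') - C1 a| ≤ L * ‖s' - sParam a‖ ∧ |C0 (aOfS s') - C0 a| ≤ L * ‖s' - sParam a‖ := by
  have h := regular_stable_aOfS (s := sParam a) hopen (by rwa [aOfS_sParam])
  simpa only [aOfS_sParam] using h

/-! ### `γ` inherits the log-cusp of `Φ` at every Regular open-box direction — unconditionally -/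

/-- **THE LOG-CUSP OF `γ` AT A REGULAR DIRECTION** (`gamma_logCusp_of_lipschitz` with its Lipschitz hypotheses on
`C₁`, `C₀` DISCHARGED by `regular_stable`). On the open box, at a Regular direction with `Q = C₁ + δ₂₈ − Φ > 0`, for
every period `T` and displacement `δ`: there are `σ` (the slope of `phi30_logCusp`, characterised by Lemma B), `C′`
and `ε₄ > 0` with `|γ(s(a)+εδ) − γ(a) − ((C₁−C₀)/Q²)·(σ/T)·ε·log(1/ε)| ≤ C′·ε` for all `0 < ε ≤ ε₄`. -/
theorem gamma_logCusp_of_regular {a : Dir}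
    (hopen : ∀ j : Fin 7, 0 < sParam a j.succ ∧ sParam a j.succ < sParam a 0)
    {T : ℝ} (hT : 0 < T) (hper : ∀ k : Fin 28, ∃ z : ℤ, T * h28 a k = z) (δ : Fin 8 → ℝ)
    (hQ : 0 < C1 a + delta28 a - phi30 a) (hreg : Regular a) :
    ∃ σ C' ε₄ : ℝ, 0 < ε₄ ∧
      (∀ ρ, 0 < ρ → ρ * clusterBound a δ < 1 → ρ * clusterBound a δ < wallDist a T →
        (∀ m, m + 1 < (bkpts a T).card → 2 * ρ * clusterWidth a δ ≤ bkpt a T (m + 1) - bkpt a T m) →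
        translateIntegral a T (ρ • δ) - translateIntegral a T 0 = ρ * σ) ∧
      ∀ ε, 0 < ε → ε ≤ ε₄ →
        |gamma (aOfS (sParam a + ε • δ)) - gamma a
          - (C1 a - C0 a) / (C1 a + delta28 a - phi30 a) ^ 2 * (σ / T) * ε * Real.log (1 / ε)| ≤ C' * ε := by
  obtain ⟨η, L, hη, hL, hall⟩ := regular_stable hopen hreg
  have hε₃ : 0 < η / (‖δ‖ + 1) := by positivity
  have hstep : ∀ ε, 0 < ε → ε ≤ η / (‖δ‖ + 1) →
      ‖sParam a + ε • δ - sParam a‖ = ε * ‖δ‖ ∧ ‖sParam a + ε • δ - sParam a‖ ≤ η := by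
    intro ε hε hεle
    have hnorm : ‖sParam a + ε • δ - sParam a‖ = ε * ‖δ‖ := by
      rw [add_sub_cancel_left, norm_smul, Real.norm_eq_abs, abs_of_pos hε]
    refine ⟨hnorm, ?_⟩
    rw [hnorm]
    calc ε * ‖δ‖ ≤ η / (‖δ‖ + 1) * ‖δ‖ := mul_le_mul_of_nonneg_right hεle (norm_nonneg _)
      _ ≤ η / (‖δ‖ + 1) * (‖δ‖ + 1) := mul_le_mul_of_nonneg_left (by linarith) hε₃.le
      _ = η := by field_simp
  refine gamma_logCusp_of_lipschitz hopen hT hper δ hQ (L := L * ‖δ‖) (ε₃ := η / (‖δ‖ + 1)) (by positivity) hε₃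
    ?_ ?_
  · intro ε hε hεle
    obtain ⟨hnorm, hle⟩ := hstep ε hε hεle
    have h := (hall _ hle).2.2.1
    rw [hnorm] at h
    calc |C1 (aOfS (sParam a + ε • δ)) - C1 a| ≤ L * (ε * ‖δ‖) := h
      _ = L * ‖δ‖ * ε := by ring
  · intro ε hε hεle
    obtain ⟨hnorm, hle⟩ := hstep ε hε hεle
    have h := (hall _ hle).2.2.2
    rw [hnorm] at h
    calc |C0 (aOfS (sParam a + ε • δ)) - C0 a| ≤ L * (ε * ‖δ‖) := h
      _ = L * ‖δ‖ * ε := by ring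

/-! ### Openness in `Dir` and continuity of `C₁`, `C₀`, `γ` on the Regular open-box stratum -/

/-- The symmetric parameters depend continuously (linearly) on the direction. -/
theorem continuous_sParam : Continuous (sParam : Dir → (Fin 8 → ℝ)) := by
  refine continuous_pi fun i => ?_
  fin_cases i <;> simp [sParam] <;> fun_prop

/-- The open box is an open set of directions. -/
theorem isOpen_openBox : IsOpen {a : Dir | ∀ j : Fin 7, 0 < sParam a j.succ ∧ sParam a j.succ < sParam a 0} := by
  have hopen : IsOpen {t : Fin 8 → ℝ | ∀ j : Fin 7, 0 < t j.succ ∧ t j.succ < t 0} := by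
    simp only [Set.setOf_forall]
    exact isOpen_iInter_of_finite fun j =>
      (isOpen_lt continuous_const (continuous_apply _)).inter (isOpen_lt (continuous_apply _) (continuous_apply _))
  exact hopen.preimage continuous_sParam

/-- **The Regular open-box directions form an OPEN set** in `Dir = ℝ⁸`. -/
theorem isOpen_regular_openBox :
    IsOpen {a : Dir | (∀ j : Fin 7, 0 < sParam a j.succ ∧ sParam a j.succ < sParam a 0) ∧ Regular a} := by
  have hS : IsOpen {t : Fin 8 → ℝ | (∀ j : Fin 7, 0 < t j.succ ∧ t j.succ < t 0) ∧ Regular (aOfS t)} := by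
    rw [Metric.isOpen_iff]
    rintro t ⟨hbox, hreg⟩
    obtain ⟨η, L, hη, -, hall⟩ := regular_stable_aOfS hbox hreg
    refine ⟨η, hη, fun t' ht' => ?_⟩
    rw [Metric.mem_ball, dist_eq_norm] at ht'
    exact ⟨(hall t' ht'.le).1, (hall t' ht'.le).2.1⟩
  have hset : {a : Dir | (∀ j : Fin 7, 0 < sParam a j.succ ∧ sParam a j.succ < sParam a 0) ∧ Regular a}
      = sParam ⁻¹' {t : Fin 8 → ℝ | (∀ j : Fin 7, 0 < t j.succ ∧ t j.succ < t 0) ∧ Regular (aOfS t)} := by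
    ext a
    simp only [Set.mem_preimage, Set.mem_setOf_eq, aOfS_sParam]
  rw [hset]
  exact hS.preimage continuous_sParam

/-- From a local Lipschitz bound in the symmetric coordinates to continuity in the direction. -/
theorem continuousAt_of_sParam_bound {f : Dir → ℝ} {a : Dir} {η L : ℝ} (hη : 0 < η) (hL : 0 ≤ L)
    (h : ∀ s' : Fin 8 → ℝ, ‖s' - sParam a‖ ≤ η → |f (aOfS s') - f a| ≤ L * ‖s' - sParam a‖) :
    ContinuousAt f a := by
  have hsc : ContinuousAt sParam a := continuous_sParam.continuousAt
  rw [Metric.continuousAt_iff] at hsc ⊢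
  intro ε hε
  obtain ⟨δ, hδ, hδs⟩ := hsc (min η (ε / (L + 1))) (by positivity)
  refine ⟨δ, hδ, fun {a'} ha' => ?_⟩
  have hs' := hδs ha'
  rw [dist_eq_norm] at hs'
  have hb := h (sParam a') (hs'.le.trans (min_le_left _ _))
  rw [aOfS_sParam] at hb
  rw [Real.dist_eq]
  calc |f a' - f a| ≤ L * ‖sParam a' - sParam a‖ := hb
    _ ≤ L * (ε / (L + 1)) := mul_le_mul_of_nonneg_left (hs'.le.trans (min_le_right _ _)) hL
    _ < ε := by
        rw [mul_div_assoc', div_lt_iff₀ (by positivity)]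
        nlinarith

/-- **`C₁` is continuous at every Regular open-box direction.** -/
theorem continuousAt_C1_of_regular {a : Dir}
    (hopen : ∀ j : Fin 7, 0 < sParam a j.succ ∧ sParam a j.succ < sParam a 0) (hreg : Regular a) :
    ContinuousAt C1 a := by
  obtain ⟨η, L, hη, hL, hall⟩ := regular_stable hopen hreg
  exact continuousAt_of_sParam_bound hη hL fun s' hs' => (hall s' hs').2.2.1

/-- **`C₀` is continuous at every Regular open-box direction.** -/
theorem continuousAt_C0_of_regular {a : Dir}
    (hopen : ∀ j : Fin 7, 0 < sParam a j.succ ∧ sParam a j.succ < sParam a 0) (hreg : Regular a) :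
    ContinuousAt C0 a := by
  obtain ⟨η, L, hη, hL, hall⟩ := regular_stable hopen hreg
  exact continuousAt_of_sParam_bound hη hL fun s' hs' => (hall s' hs').2.2.2

/-- `δ₂₈` is continuous everywhere (10-Lipschitz in the symmetric coordinates, `abs_delta28_sub_le_sParam`). -/
theorem continuousAt_delta28 (a : Dir) : ContinuousAt delta28 a := by
  refine continuousAt_of_sParam_bound (η := 1) (L := 10) one_pos (by norm_num) fun s' _ => ?_
  have h : ∀ i : Fin 8, |sParam (aOfS s') i - sParam a i| ≤ ‖s' - sParam a‖ := by
    intro i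
    rw [sParam_aOfS]
    have := norm_le_pi_norm (s' - sParam a) i
    simpa [Real.norm_eq_abs] using this
  exact abs_delta28_sub_le_sParam h

/-- `Φ` is continuous at every open-box direction (the tree's `continuousWithinAt_phi30` on the closed box, which is
a neighbourhood of every open-box direction). -/
theorem continuousAt_phi30_of_openBox {a : Dir}
    (hopen : ∀ j : Fin 7, 0 < sParam a j.succ ∧ sParam a j.succ < sParam a 0) : ContinuousAt phi30 a := by
  refine (continuousWithinAt_phi30 (BZBox_of_openBox hopen)).continuousAt ?_
  exact Filter.mem_of_superset (isOpen_openBox.mem_nhds hopen) fun b hb => BZBox_of_openBox hb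

/-- **`γ` is continuous at every Regular open-box direction whose denominator `C₁ + δ₂₈ − Φ` is non-zero.** -/
theorem continuousAt_gamma_of_regular {a : Dir}
    (hopen : ∀ j : Fin 7, 0 < sParam a j.succ ∧ sParam a j.succ < sParam a 0) (hreg : Regular a)
    (hQ : C1 a + delta28 a - phi30 a ≠ 0) : ContinuousAt gamma a := by
  have h1 := continuousAt_C1_of_regular hopen hreg
  have h0 := continuousAt_C0_of_regular hopen hreg
  have hd := continuousAt_delta28 a
  have hp := continuousAt_phi30_of_openBox hopen
  change ContinuousAt (fun b => (C1 b - C0 b) / (C1 b + delta28 b - phi30 b)) a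
  exact (h1.sub h0).div ((h1.add hd).sub hp) hQ

end Summit.KontsevichZagierPeriods.Zeta5Search.Barrier.ConeGamma

end
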